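import Summits.HodgeConjecture.HodgeConjecture.Theorems.F0P6aStubDOWN
import HarnessLib
import HarnessLib.Audit.LibrarySuggestionsDenyListCruxes

/-!
# F0_P6a_StubDOWN — ED. 6 = SHIM (K6 L2 column re-home; pen LA2-plan (g5) PLAN «L2 cone RE-HOME» v1.4; ★ parts = v3e set (LA2-p03 (g7) v3″ canon + LEAD «M-150f» (A) import move, staged by «L1» LA1-p02 (g9), DEAL 12∕12a), filer LA1-p02 (g9) (alt LA2-p01 (g6)); box LAref-D first ∕ LA-ref1 second; TEMPLATE by LA2-p03 (g7) v2tmpl 858abbac, DEAL 6 + DEAL 8a (α); header re-trued by the pen)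

Every declaration of the tree workfile `Lines/F0_P6a_StubDOWN.lean` (ED. 5, sha16 e250f7eaf0d80e96, 1984 l., sorry-free, stub-free; 85 declarations = 65 theorems + 20 def-like:
`SheetDecompLaw`, `RedTranslLaw`, `RedQuotLaw`, `CanonicalLineLaw`, `SpSurjLaw`, `LayerIsoLaw`, `aut_mul_hom`, `isoMk_aut_mul_hom`, `actOf_mul`, `DockIsoAt`, …, last head `stub_DOWN_of_organs`)
now lives, byte for byte and under the SAME namespace `Summit.HodgeConjecture.HodgeConjecture.Cruxes.HLiu418.F0P6aStubDOWN`, in the ★ chain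
★ `Theorems/F0P6aStubDOWNLaws.lean` (p853394) → ★ `Theorems/F0P6aStubDOWNProvider.lean` (p853407) → ★ `Theorems/F0P6aStubDOWNSpecKey.lean` (p853424) → ★ `Theorems/F0P6aStubDOWNSpecHeads.lean` (p853435) → ★ `Theorems/F0P6aStubDOWNOrgans.lean` (p853558) → ★ `Theorems/F0P6aStubDOWNTransport.lean` (p853572) → ★ `Theorems/F0P6aStubDOWN.lean` (p853585) (LAST part = plain stem; each part imports the previous); this module keeps its name so that its tree importers
(`Lines/F0_P6a_ModuliDatum.lean` (MAIN)) and any by-name reader under `open …F0P6aStubDOWN` resolve unchanged through the import above.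
It declares ONE thing, hub-side: the (α) ALIAS-IDENTICAL letter `stub_RHO1` (LEAD F0P6-plan (g6) «M-142g» (A)(d2) ∕ «M-142h» (iv); LA2-plan DEAL 8a): its statement is
★ `…F0P6aLineSpecialisation.exists_quotLegReduction` TOKEN FOR TOKEN (1 103∕1 103 tokens, same frame) and its proof the bare by-term application, so it cannot twin ★-side
(`dedup.landed`); it is restored HERE verbatim (tree ED. 5 :1084–:1181 = banner + `section PendingHeads`: `open`s + frame + the letter) under the namespace-level `open`s of
the leaf (ED. 5 :85–:102 verbatim), so the FQN `…F0P6aStubDOWN.stub_RHO1` survives in `Lines/` exactly as hub ED. 4 v4 keeps `stub_LINES`. 0 code readers today (MAIN :656 reads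
`stub_DOWN_of_organs` only, which is ★). The ★ twin՚s `stub_SPEC` pays over the head term directly. `exists₂_dropLast` (≡ ★ `…F0P6aStubFROBQuotWD.exists₂_take₈`) is
handled ★-side per «M-142h» (iii′) (an `alias` in ★ PART 2), not here.
ORDER NOTE: written under the standing wave rule («M-150» (2)∕(3), coupling (6): after ★ R2 `SpecOrgansT` + ★ R5 `StubRHO1` + ★ L3 `StubFROBQuotWD`) after EVERY ★ part above is ACCEPTED and served (NO-CROSS-IMPORT: no environment may hold
a `Lines/` ORIGINAL of this column together with its ★ twin); an importer smoke that reads «environment already contains …» before the wave՚s request is BUILT is this order note,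
not a defect.  Edition history stays in the line card `Lines/F0_P6a_StubDOWN.md` and in git; future changes are ★-side proposals on the `Theorems/` files.
HC_CM is proved only modulo the 7 printed citations (2 remaining named inputs: hLiu418 = stmt-HodgeConjecture-24832, h413 = stmt-HodgeConjecture-24833) until rung 0 closes; count-neutral (0 `sorry`, 0 socket, 1 declaration (the restored letter)). -/

set_option autoImplicit false
set_option linter.dupNamespace false

noncomputable section

namespace Summit.HodgeConjecture.HodgeConjecture.Cruxes.HLiu418.F0P6aStubDOWN

open CategoryTheory CategoryTheory.Limits NumberField IsDedekindDomain MulAction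
open scoped Matrix Polynomial Pointwise MonoidalCategory
open Literature.NumberTheory.GaloisRepresentations
open Literature.NumberTheory.Automorphic Literature.NumberTheory.Automorphic.UnitaryGroup
open Literature.AlgebraicGeometry.ShimuraVarieties.UnitaryCanonicalModel
open Literature.NumberTheory.Automorphic.Liu2021.AppendixC
open Literature.AlgebraicGeometry.Motives (AlgPoints IntegralModel SchemeOver thickening thickeningGalAction thickeningLift specOver relFrobeniusOver frobeniusTwistOver)
open Literature.NumberTheory.DiophantineGeometry (geomResidueField specialFibreFunctor specResidueField)
open Literature.AlgebraicGeometry.RelativeSpec (ActionOver)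
open Literature.NumberTheory.EllipticCurves (genericFibre)
open Literature.AlgebraicGeometry.GroupSchemes.AffineGroupScheme (Alg quotIncl)
open Summit.HodgeConjecture.HodgeConjecture.Cruxes.HLiu418.F0P6cDictConstructors (kerFI AdmSub IdealIsEtale isAdm_kerFI)
open Summit.HodgeConjecture.HodgeConjecture.Cruxes.HLiu418.F0P6aModuliDatumDefs
open Summit.HodgeConjecture.HodgeConjecture.Cruxes.HLiu418.F0P6aRGDAssembly
open Summit.HodgeConjecture.HodgeConjecture.Cruxes.HLiu418.F0P6aDatumOfInputs
open Summit.HodgeConjecture.HodgeConjecture.Cruxes.HLiu418.F0P6aLineSpecialisation (spGeoOf canonicalLine_spGeoOf spGeoOf_surjective hrkG_of_dock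
  exists_isogW₀_of_quotLeg mono_coverPin₀ le_ker_isogW₀_of_himg red₀Of_translΩ_eq_of_red₀Of_eq red₀Of_quotΩ_eq_red₀Of_translΩ_of_le_ker_layer
  red₀Of_quotΩ_eq_of_quotLegReduction₀)  -- [ED. 4] organ heads BY NAME (incl. the §Q head `red₀Of_quotΩ_eq_of_quotLegReduction₀`, PART B)

-- ── tree ED. 5 :1084–:1181 VERBATIM (the (α) letter `stub_RHO1` with its frame; body = the ★ head BY TERM) ──
/-! ### §Σ′ PENDING HEAD — the one organ head not yet served, as a NAMED finer socket (statement = the producer's head type VERBATIM); the [WQ] head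
`red₀Of_quotΩ_eq_of_quotLegReduction₀` is SERVED (PART B `Lines/F0_P6a_SpecOrgansT.lean` §Q, LA6-p01 (g3)) and consumed BY NAME in `stub_SPEC`'s payment term -/

section PendingHeads

open scoped MonObj CategoryTheory.Obj
open AlgebraicGeometry
open Literature.AlgebraicGeometry.AbelianSchemes Literature.AlgebraicGeometry.AbelianSchemes.AbelianSchemeOver
open Summit.HodgeConjecture.HodgeConjecture.Cruxes.HLiu418.F0P6aLineSpecialisation (spGeoOf canonicalLine_spGeoOf spGeoOf_surjective)

-- the frame of the D-line՚s `Letters` section ⊕ `[IsGalois ℚ F]` after `[IsCMField F]` (LA1-plan (g5) 10:36:21Z (a) ∕ LA2-plan (g2) FIX-1 11:50:22Z: the (ρ1𝒞) head՚s frame token, auto-bound as binder #5)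
variable {F : Type} [Field F] [NumberField F] [IsCMField F] [IsGalois ℚ F] {ι₁ : F →+* ℂ}
    {Jstar : Matrix (Fin 2) (Fin 2) F}
    {K₀ : C5.OpenCompactSubgroup ↥(finAdelic ↥(maximalRealSubfield F) F (IsCMField.complexConj F) 2 Jstar)}
    {S : RecordSystemGS F Jstar ι₁ K₀} {hU7ₛ : S.HeckeTranslateDefinedOver}
    {hJ : (Jstar.map (IsCMField.complexConj F))ᵀ = Jstar} {hJu : IsUnit Jstar}
    {Fi : Type} [Field Fi] [Algebra F Fi] {Kc : C5.SmallLevel K₀} {G : Type} [Group G]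
    {𝓜 : IntegralModel (𝓞 F) F ((thickening F Fi).obj (S.M.obj Kc))}
    {w : HeightOneSpectrum (𝓞 F)} {hw : (IsCMField.complexConj F) • w ≠ w} {h𝓨 : (𝓜.localise w).IsSmoothProper 1}
    {θ : ActionOver (𝓜.localise w).total.hom ((Fi ≃ₐ[F] Fi) × G)}
    {e : Fi →ₐ[F] AlgebraicClosure (w.adicCompletion F)}

set_option maxHeartbeats 400000 in
/-- **`stub_RHO1` — NAMED SOCKET for the (ρ1𝒞) v3 head `exists_quotLegReduction`** (LA1-p01 (g3)): binder order of record (LA2-plan (g2) 09:29:54Z (1)) `𝔡 quotΩ translΩ hhecke hroof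
hroof₂ hunit hKc`, Serre letters, `(y) (L)`; rows = (ρ1𝒞) v2 dd38f771 rows ((FLAT-SURJ)(ACT)(LVL)(SIM)(K2-gen)) ∧ (RK) ∧ (KILL) ∧ (DOCK) ∧ (IMG) shape (a) LAST.  ED. 5 replaces this
`sorry` by ONE name: `exists_quotLegReduction I`. [cite: Liu2021, Prop. D.8 (2)(3) p. 135, pp. 136–138] [cite: SerreTate1968, §1 Lemma 2] [cite: MumfordAV1970, §7 Thm. 4 (p. 72)] -/
theorem stub_RHO1 (I : RGDInputsAt F ι₁ Jstar K₀ S hU7ₛ hJ hJu Fi Kc G 𝓜 w hw h𝓨 θ e) [ExpChar (geomResidueField w) I.pChar]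
    (𝔡 : ∀ xbar, DockAt I xbar)
    -- SOCKET ORDER OF RECORD (LA2-plan (g2) 09:29:54Z (1)): `𝔡 quotΩ translΩ hhecke hroof hroof₂ hunit hKc`, THEN the Serre letters, THEN `(y) (L)`; no `hunr`∕`hpN` head binders
    (quotΩ : ∀ y, LineOf I y → AlgPoints (S.M.obj Kc) (AlgebraicClosure (w.adicCompletion F)))
    (translΩ : AlgPoints (S.M.obj Kc) (AlgebraicClosure (w.adicCompletion F)) → AlgPoints (S.M.obj Kc) (AlgebraicClosure (w.adicCompletion F)))
    (_hhecke : HeckeClause I quotΩ translΩ) (_hroof : RoofLink I quotΩ) (_hroof₂ : RoofLink₂ I translΩ)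
    (_hunit : (UnitaryGroup.isUnit_placeForm Jstar hJu w).unit ∈ glInt 2 (w.adicCompletion F))
    (_hKc : UnitaryGroup.IsHyperspecialAt ↥(maximalRealSubfield F) F (IsCMField.complexConj F) 2 Jstar Kc.1.1
      (w.under (𝓞 ↥(maximalRealSubfield F))))
    {m : ℕ} (E' : Matrix (Fin m) (Fin m) (𝓞 F)) (hE' : E' * E' = E') (P : Matrix (Fin m) (Fin 1) (𝓞 F)) (Q : Matrix (Fin 1) (Fin m) (𝓞 F))
    (_hP : E' * P = P) (_hQ : Q * E' = Q) (_hQP : Q * P = Matrix.scalar (Fin 1) (I.pChar : 𝓞 F))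
    (_hPQ : P * Q = Matrix.scalar (Fin m) (I.pChar : 𝓞 F) * E') (_h𝔭 : Ideal.span (Set.range fun k => P k 0) = w.asIdeal)
    (y : AlgPoints (S.M.obj Kc) (AlgebraicClosure (w.adicCompletion F))) (L : LineOf I y) :
    haveI := I.comm
    letI := (𝔡 (red₀Of S Kc 𝓜 w h𝓨 e y)).grp₀
    haveI := (𝔡 (red₀Of S Kc 𝓜 w h𝓨 e y)).aff₀
      ∃ (ψ : (sch₀Of 𝓜 w I.univ (red₀Of S Kc 𝓜 w h𝓨 e y)).X ⟶ (sch₀Of 𝓜 w (serreTensor I.act E' hE') (red₀Of S Kc 𝓜 w h𝓨 e (quotΩ y L))).X) (_ : IsMonHom ψ),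
        -- (FLAT-SURJ)
        (Flat ψ.left ∧ Function.Surjective ψ.left.base) ∧
        -- (ACT) `𝒪_F`-equivariance, `act₀Of` currency on both sides (`serreAction` on `𝒞`)
        (∀ a : 𝓞 F, (act₀Of 𝓜 w I.univ I.act a (red₀Of S Kc 𝓜 w h𝓨 e y)).hom.hom.hom ≫ ψ =
          ψ ≫ (act₀Of 𝓜 w (serreTensor I.act E' hE') (serreAction I.act E' hE') a (red₀Of S Kc 𝓜 w h𝓨 e (quotΩ y L))).hom.hom.hom) ∧
        -- (LVL) level points: `ψ(σᵃ(x̄)) = (σᵃ ≫ ψ_P)(x̄″)`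
        (∀ a : Fin I.g ⊕ Fin I.g → ZMod I.N,
          AlgPoints.map ψ (lvlPt₀Of 𝓜 w I.univ I.lvl (red₀Of S Kc 𝓜 w h𝓨 e y) a) =
            ((serreTensor I.act E' hE').baseChange (pullback.fst (𝓜.localise w).total.hom (specResidueField w))).restrictPt (red₀Of S Kc 𝓜 w h𝓨 e (quotΩ y L)).left
              ((serreTensor I.act E' hE').sectionBaseChange (pullback.fst (𝓜.localise w).total.hom (specResidueField w)) (I.lvl.section_ a ≫ serreTranslate I.act E' hE' P))) ∧
        -- (SIM) for EVERY downstairs dual pair of `𝒞_{x̄″}` through which the cover leg pulls back to `λ ≫ [p]`: `ψ^* λ_B̄ = λ_{x̄} ≫ [p]`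
        (∀ (DBs : (sch₀Of 𝓜 w (serreTensor I.act E' hE') (red₀Of S Kc 𝓜 w h𝓨 e (quotΩ y L))).DualPair)
          (_ : Nonempty ((Scheme.Modules.pullback (DualPair.unitHatSlice DBs)).obj DBs.P ≅ SheafOfModules.unit _))
          (lamBs : (sch₀Of 𝓜 w (serreTensor I.act E' hE') (red₀Of S Kc 𝓜 w h𝓨 e (quotΩ y L))).X ⟶ DBs.hat.X) [IsMonHom lamBs],
          (haveI := isMonHom_coverLeg (pullback.fst (𝓜.localise w).total.hom (specResidueField w)) (red₀Of S Kc 𝓜 w h𝓨 e (quotΩ y L)).left I.act E' hE' P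
           baseChangeHom (baseChangeHom (serreTranslate I.act E' hE' P) (pullback.fst (𝓜.localise w).total.hom (specResidueField w))) (red₀Of S Kc 𝓜 w h𝓨 e (quotΩ y L)).left ≫ lamBs ≫
              DualPair.dualIsogenyOver (baseChangeHom (baseChangeHom (serreTranslate I.act E' hE' P) (pullback.fst (𝓜.localise w).total.hom (specResidueField w))) (red₀Of S Kc 𝓜 w h𝓨 e (quotΩ y L)).left)
                (dual₀Of 𝓜 w I.univ I.dual (red₀Of S Kc 𝓜 w h𝓨 e (quotΩ y L))) DBs =
            (pol₀Of 𝓜 w I.univ I.pol (red₀Of S Kc 𝓜 w h𝓨 e (quotΩ y L))).lam ≫ (dual₀Of 𝓜 w I.univ I.dual (red₀Of S Kc 𝓜 w h𝓨 e (quotΩ y L))).hat.mulN I.pChar) →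
          ψ ≫ lamBs ≫ DualPair.dualIsogenyOver ψ (dual₀Of 𝓜 w I.univ I.dual (red₀Of S Kc 𝓜 w h𝓨 e y)) DBs =
            (pol₀Of 𝓜 w I.univ I.pol (red₀Of S Kc 𝓜 w h𝓨 e y)).lam ≫ (dual₀Of 𝓜 w I.univ I.dual (red₀Of S Kc 𝓜 w h𝓨 e y)).hat.mulN I.pChar) ∧
        -- (K2-gen) every ideal bound on the kernel descends: `Ker q(Ω̄) ⊆ A_y[𝔞](Ω̄)` for the upstairs leg is recorded through `L`'s roof, so downstairs:
        (∀ 𝔞 : Ideal (𝓞 F), (∀ Pt ∈ L.1, IsIdealTorsionΩ S Kc 𝓜 w e I.univ I.act y 𝔞 Pt) →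
          (∀ Pt : (fibreΩOf S Kc 𝓜 w e I.univ y).Points (AlgebraicClosure (w.adicCompletion F)),
            (∀ r ∈ w.asIdeal * ((IsCMField.complexConj F) • w).asIdeal, (AlgPoints.map (actΩOf S Kc 𝓜 w e I.univ I.act r y).hom.hom.hom Pt :
              (fibreΩOf S Kc 𝓜 w e I.univ y).Points (AlgebraicClosure (w.adicCompletion F))) = 1) → IsIdealTorsionΩ S Kc 𝓜 w e I.univ I.act y 𝔞 Pt) →
          ∀ ⦃T : SchemeOver (geomResidueField w)⦄ (z : T ⟶ (sch₀Of 𝓜 w I.univ (red₀Of S Kc 𝓜 w h𝓨 e y)).X),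
            z ≫ ψ = 1 → ∀ r ∈ 𝔞, z ≫ (act₀Of 𝓜 w I.univ I.act r (red₀Of S Kc 𝓜 w h𝓨 e y)).hom.hom.hom = 1) ∧
        -- (RK) the rank of `Ker ψ`, BY VALUE for every closed realisation (LA2-p04 (g2) (C6′) `hrkᵢ` text)
        (∀ (K : SchemeOver (geomResidueField w)) [GrpObj K] [IsAffine K.left] [Module.Finite (geomResidueField w) (Alg K)]
          (κ : K ⟶ (sch₀Of 𝓜 w I.univ (red₀Of S Kc 𝓜 w h𝓨 e y)).X) [IsMonHom κ] [IsClosedImmersion κ.left],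
          (∀ ⦃T : SchemeOver (geomResidueField w)⦄ (t : T ⟶ (sch₀Of 𝓜 w I.univ (red₀Of S Kc 𝓜 w h𝓨 e y)).X), (∃ s : T ⟶ K, s ≫ κ = t) ↔ t ≫ ψ = 1) →
          Module.finrank (geomResidueField w) (Alg K) = I.pChar ^ I.fDeg * I.pChar ^ I.fDeg) ∧
        -- (KILL) `ψ` kills `V(spGeoOf y L) ↪ G₀(x̄) ↪ A_{x̄}`
        quotIncl (𝔡 (red₀Of S Kc 𝓜 w h𝓨 e y)).G₀ (spGeoOf I 𝔡 y L).1 ≫ (𝔡 (red₀Of S Kc 𝓜 w h𝓨 e y)).ι₀G ≫ ψ = 1 ∧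
        -- (DOCK) `Ker ψ ∩ G₀(x̄) = V(spGeoOf y L)` on all `T`-points of the dock
        (∀ ⦃T : SchemeOver (geomResidueField w)⦄ (t : T ⟶ (𝔡 (red₀Of S Kc 𝓜 w h𝓨 e y)).G₀),
          t ≫ (𝔡 (red₀Of S Kc 𝓜 w h𝓨 e y)).ι₀G ≫ ψ = 1 ↔
            ∃ s : T ⟶ specOver (geomResidueField w) (Alg (𝔡 (red₀Of S Kc 𝓜 w h𝓨 e y)).G₀ ⧸ (spGeoOf I 𝔡 y L).1),
              s ≫ quotIncl (𝔡 (red₀Of S Kc 𝓜 w h𝓨 e y)).G₀ (spGeoOf I 𝔡 y L).1 = t) ∧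
        -- (IMG) row, SHAPE (a) of record (LA2-plan (g2) 09:18:21Z (2)): the BACKTRACKING line `L_b` with `himg` (LA2-p03 (g3) f3424bb3 :279–:285 text at `H″ := spGeoOf I 𝔡 (quotΩ y L) L_b`)
        ∃ Lb : LineOf I (quotΩ y L), quotΩ (quotΩ y L) Lb = translΩ y ∧
          (letI := (𝔡 (red₀Of S Kc 𝓜 w h𝓨 e (quotΩ y L))).grp₀; haveI := (𝔡 (red₀Of S Kc 𝓜 w h𝓨 e (quotΩ y L))).aff₀;
            ∀ ⦃T : SchemeOver (geomResidueField w)⦄ (t : T ⟶ (𝔡 (red₀Of S Kc 𝓜 w h𝓨 e y)).G₀),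
              ∃ s : T ⟶ specOver (geomResidueField w) (Alg (𝔡 (red₀Of S Kc 𝓜 w h𝓨 e (quotΩ y L))).G₀ ⧸ (spGeoOf I 𝔡 (quotΩ y L) Lb).1),
                s ≫ quotIncl (𝔡 (red₀Of S Kc 𝓜 w h𝓨 e (quotΩ y L))).G₀ (spGeoOf I 𝔡 (quotΩ y L) Lb).1 ≫ (𝔡 (red₀Of S Kc 𝓜 w h𝓨 e (quotΩ y L))).ι₀G ≫
                    baseChangeHom (baseChangeHom (serreTranslate I.act E' hE' P) (pullback.fst (𝓜.localise w).total.hom (specResidueField w))) (red₀Of S Kc 𝓜 w h𝓨 e (quotΩ y L)).left =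
                  t ≫ (𝔡 (red₀Of S Kc 𝓜 w h𝓨 e y)).ι₀G ≫ ψ)
    := by
  -- LEAF ED. 5 PAYMENT HUNK (e5, LA1-p02 (g5) for LA2-plan (g3) 2026-09-02): the (ρ1𝒞) head BY ONE NAME; statement bytes of `stub_RHO1` untouched;
  -- binders passed by name in the socket order of record; instances (`ExpChar`, `I.comm`∕dock `letI`∕`haveI` of the statement) found by unification — no `haveI` prefix («M-105» (R1)(R3)).
  exact Summit.HodgeConjecture.HodgeConjecture.Cruxes.HLiu418.F0P6aLineSpecialisation.exists_quotLegReduction I 𝔡 quotΩ translΩ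
    _hhecke _hroof _hroof₂ _hunit _hKc E' hE' P Q _hP _hQ _hQP _hPQ _h𝔭 y L

end PendingHeads

end Summit.HodgeConjecture.HodgeConjecture.Cruxes.HLiu418.F0P6aStubDOWN

end
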